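import Literature.AlgebraicGeometry.HodgeTheory.CMHodgeGroupDerivedAlgebra
import Literature.Algebra.Lie.LieGoursatTwist
import HarnessLib

/-!
# No twist between the `𝔰𝔩(W_σ)`-blocks of `Lie Hg` for a CM field with one `Θ`-scalar place: the LIFT property
# (Moonen–Zarhin 1999 §2 (2.3); Ribet 1983 §3; Deligne LNM 900 I §3)

Family `hodge`, layer `Literature/AlgebraicGeometry/HodgeTheory` (brick P3 of the design note
`HOME/jobs/A7-inventory-eng5g6/DESIGN-rows10-12-allmembers.md` of the cell `pub-hodgeav-hg6`, req-37 (A) Q2b, TABLE X row 12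
ALL MEMBERS, pattern `(n_σ) = (2,1,1)`; continues `CMHodgeGroupDerivedAlgebra`). UNCONDITIONAL; theorems only, no definition,
no named fact, no `sorry`. HONEST FRAMING of that cell: HC / HC_AV / HC_CM / H2 NOT proved — linear algebra of polarized
weight-one Hodge structures.

SETTING as in `CMDerived.*`: `n₀ = 2` (every `W_{μ k}` is a plane), `|ι| ≤ 3`, an admissible bracket-closed `𝔤 ∋ Θ` acting
irreducibly on every `W_{μ k}`, and ONE `Θ`-SCALAR place `k₀` (`W_{μ k₀} ⊆ V^{1,0}` or `⊆ V^{0,1}`), all other places BALANCED.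
* §1 `CMNoTwist.theta_eq_smul_of_unbalanced`, `CMNoTwist.false_of_theta_commute_of_balanced` (`Θ|_{W}` cannot commute with
  an irreducible `𝔤_ℂ|_W` on a balanced plane), `CMNoTwist.adjoint_baseChange_apply` (`φ†` acts on `W_{μ k}` by `conj (μ k)`:
  the Rosati involution is complex conjugation on `E`), `CMNoTwist.eq_zero_of_conj_submatrix_eq_zero` (matrix plumbing).
* §2 **`CMNoTwist.lift_of_unique_unbalanced`** — THE LIFT PROPERTY (the input `hlift` of `CMThetaSocket.mem_spanC_of_lift_of_centre`
  and of `CMThetaCentre.*`): every traceless endomorphism of `W_{μ k}` is induced by an element of `𝔤_ℂ` killing the other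
  `W_{μ j}`. PROOF (Galois-free): Ribet's Lie lemma in the tree's form `LieGoursatTwist.lift_or_twist_of_submodules` applied to
  the complex derived span `𝔇 = (𝔡)_ℂ ⊆ ∏_k 𝔰𝔩(W_{μ k})` (surjective on each factor by `CMDerived.exists_mem_spanC_derived_forall_eq`)
  leaves, at each place, LIFT or a TWIST `[X|_{i₀}] = A⁻¹ [X|_j]^e A`. A twist between places of different type is impossible:
  `[Θ, Y] ∈ 𝔇` vanishes on the `Θ`-scalar block, hence on the other, so `Θ|_W` would commute with the irreducible `𝔤_ℂ|_W` on
  a balanced plane. A twist between the two balanced places `k, j` is impossible by the RATIONAL `b`-TRICK: for `b ∈ {φ + φ†,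
  φφ†} ⊂ E₀` with `σ_k(b) ≠ σ_j(b)`, `N′ = {X ∈ 𝔡 : bX ∈ 𝔡}` has `dim_ℚ N′ ≥ 2·6 − 9 = 3` (`dim 𝔡 ≥ 6` by LIFT at `k₀`,
  `dim (𝔡 + b𝔡) ≤ 9`), while for `X ∈ N′` the twist gives `(σ_k(b) − σ_j(b)) [X|_k] = 0`, so `X_ℂ` kills both balanced blocks
  and `X = 0` (`CMDerived.eq_zero_of_forall_balanced`).

## References
* [MoonenZarhin1999LowDim] B. Moonen, Yu. Zarhin, Math. Ann. 315 (1999), §2 (2.3).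
* [Ribet1983] K. A. Ribet, Amer. J. Math. 105 (1983), §3 (Lie algebra lemma), Thm. 0.
* [Deligne1982HodgeCycles] P. Deligne, LNM 900 (1982), I §3 (proof of Prop. 3.4), §4 (p. 30).
-/

noncomputable section

open scoped TensorProduct
open Module

namespace Literature.AlgebraicGeometry.Motives

namespace HodgeStructure

universe u

variable {V : Type u} [AddCommGroup V] [Module ℚ V] {n : ℤ}

/-! ### §1 Preliminaries -/

/-- **Conjugation by an invertible matrix and reindexing detect zero** (plumbing for the twist alternative of
`LieGoursatTwist.lift_or_twist_of_submodules`). [cite: Ribet1983, §3] -/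
theorem CMNoTwist.eq_zero_of_conj_submatrix_eq_zero {d : ℕ} (e : Fin d ≃ Fin d) {A : Matrix (Fin d) (Fin d) ℂ}
    (hA : IsUnit A) {M : Matrix (Fin d) (Fin d) ℂ} (h : A⁻¹ * M.submatrix e.symm e.symm * A = 0) : M = 0 := by
  have hdet : IsUnit A.det := (Matrix.isUnit_iff_isUnit_det A).1 hA
  have hS : M.submatrix e.symm e.symm = 0 := by
    calc M.submatrix e.symm e.symm = A * (A⁻¹ * M.submatrix e.symm e.symm * A) * A⁻¹ := by
          rw [← Matrix.mul_assoc, ← Matrix.mul_assoc, Matrix.mul_nonsing_inv A hdet, Matrix.one_mul, Matrix.mul_assoc,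
            Matrix.mul_nonsing_inv A hdet, Matrix.mul_one]
      _ = 0 := by rw [h, Matrix.mul_zero, Matrix.zero_mul]
  have : M = (M.submatrix e.symm e.symm).submatrix e e := by
    rw [Matrix.submatrix_submatrix, Equiv.symm_comp_self, Matrix.submatrix_id_id]
  rw [this, hS, Matrix.submatrix_zero, Pi.zero_def, Pi.zero_def]

/-- **`dim 𝔇 ≥ 6`** when `𝔇 ⊆ End(M)` induces all of `𝔰𝔩(W₁)` on a plane `W₁` and lifts all of `𝔰𝔩(W₂)` on a second
plane `W₂` by elements killing `W₁` (restriction to `W₁` has rank `≥ 3` and nullity `≥ 3`). [cite: Ribet1983, §3] -/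
theorem CMNoTwist.six_le_finrank {M : Type*} [AddCommGroup M] [Module ℂ M] [FiniteDimensional ℂ M]
    (D : Submodule ℂ (Module.End ℂ M)) (W₁ W₂ : Submodule ℂ M) (h1 : Module.finrank ℂ ↥W₁ = 2)
    (h2 : Module.finrank ℂ ↥W₂ = 2) (hD1 : ∀ X ∈ D, ∀ w ∈ W₁, X w ∈ W₁) (hD2 : ∀ X ∈ D, ∀ w ∈ W₂, X w ∈ W₂)
    (hproj : ∀ T : Module.End ℂ ↥W₁, LinearMap.trace ℂ _ T = 0 → ∃ X ∈ D, ∀ w : ↥W₁, X w = T w)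
    (hlift : ∀ T : Module.End ℂ ↥W₂, LinearMap.trace ℂ _ T = 0 →
      ∃ X ∈ D, (∀ w : ↥W₂, X w = T w) ∧ ∀ w ∈ W₁, X w = 0) :
    6 ≤ Module.finrank ℂ ↥D := by
  let ρ₁ : ↥D →ₗ[ℂ] Module.End ℂ ↥W₁ :=
    { toFun := fun X => (X : Module.End ℂ M).restrict (hD1 X X.2)
      map_add' := fun X Y => LinearMap.ext fun w => Subtype.ext (by
        simp only [Submodule.coe_add, LinearMap.add_apply, LinearMap.coe_restrict_apply])
      map_smul' := fun c X => LinearMap.ext fun w => Subtype.ext (by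
        simp only [Submodule.coe_smul, LinearMap.smul_apply, LinearMap.coe_restrict_apply, RingHom.id_apply]) }
  let ρ₂ : ↥D →ₗ[ℂ] Module.End ℂ ↥W₂ :=
    { toFun := fun X => (X : Module.End ℂ M).restrict (hD2 X X.2)
      map_add' := fun X Y => LinearMap.ext fun w => Subtype.ext (by
        simp only [Submodule.coe_add, LinearMap.add_apply, LinearMap.coe_restrict_apply])
      map_smul' := fun c X => LinearMap.ext fun w => Subtype.ext (by
        simp only [Submodule.coe_smul, LinearMap.smul_apply, LinearMap.coe_restrict_apply, RingHom.id_apply]) }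
  have hρ₁ : ∀ (X : ↥D) (w : ↥W₁), ((ρ₁ X w : ↥W₁) : M) = (X : Module.End ℂ M) (w : M) := fun X w => rfl
  have hρ₂ : ∀ (X : ↥D) (w : ↥W₂), ((ρ₂ X w : ↥W₂) : M) = (X : Module.End ℂ M) (w : M) := fun X w => rfl
  have hrange : LinearMap.ker (LinearMap.trace ℂ ↥W₁) ≤ LinearMap.range ρ₁ := by
    intro T hT
    obtain ⟨X, hX, hXT⟩ := hproj T (LinearMap.mem_ker.1 hT)
    exact ⟨⟨X, hX⟩, LinearMap.ext fun w => Subtype.ext (by rw [hρ₁, hXT w])⟩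
  have hker : LinearMap.ker (LinearMap.trace ℂ ↥W₂) ≤ (LinearMap.ker ρ₁).map ρ₂ := by
    intro T hT
    obtain ⟨X, hX, hXT, hX0⟩ := hlift T (LinearMap.mem_ker.1 hT)
    refine ⟨⟨X, hX⟩, ?_, LinearMap.ext fun w => Subtype.ext (by rw [hρ₂, hXT w])⟩
    exact LinearMap.mem_ker.2 (LinearMap.ext fun w => Subtype.ext (by
      rw [hρ₁, hX0 w w.2, LinearMap.zero_apply, Submodule.coe_zero]))
  have h3₁ := Literature.Algebra.Lie.finrank_ker_trace_eq_three (K := ℂ) h1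
  have h3₂ := Literature.Algebra.Lie.finrank_ker_trace_eq_three (K := ℂ) h2
  have e1 : 3 ≤ Module.finrank ℂ ↥(LinearMap.range ρ₁) := h3₁ ▸ Submodule.finrank_mono hrange
  have e2 : 3 ≤ Module.finrank ℂ ↥(LinearMap.ker ρ₁) :=
    (h3₂ ▸ Submodule.finrank_mono hker).trans (Submodule.finrank_map_le _ _)
  have h := LinearMap.finrank_range_add_finrank_ker ρ₁
  omega

section Hodge

variable [Module.Finite ℚ V] [HodgeTensorFacts.{u, u}]

/-- **On an unbalanced block `Θ` is `±1`**: if `W_{μ k}` does not meet `V^{1,0}` (resp. `V^{0,1}`) it lies in `V^{0,1}`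
(resp. `V^{1,0}`). [cite: Deligne1982HodgeCycles, §4 (p. 30)] -/
theorem CMNoTwist.theta_eq_smul_of_unbalanced (H : HodgeStructure V n) (hn : n = 1) (heff : H.IsEffective)
    {φ : Module.End ℚ V} (hφE : φ ∈ H.endAlg) {Θ : Module.End ℂ (ℂ ⊗[ℚ] V)}
    (hΘ : ∀ p, ∀ x ∈ H.piece p (n - p), Θ x = ((2 * p - n : ℤ) : ℂ) • x) {c : ℂ}
    (hunb : Module.finrank ℂ ↥(Module.End.eigenspace (φ.baseChange ℂ) c ⊓ H.piece 1 0) = 0 ∨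
      Module.finrank ℂ ↥(Module.End.eigenspace (φ.baseChange ℂ) c ⊓ H.piece 0 1) = 0) :
    ∃ ε : ℂ, ∀ w ∈ Module.End.eigenspace (φ.baseChange ℂ) c, Θ w = ε • w := by
  obtain ⟨-, -, hΘ10, hΘ01, -⟩ := UnitaryTheta.theta_facts H hn heff hΘ
  have hsum := CMTheta.finrank_eigenspace_eq_add H hn heff hφE c
  subst hn
  rcases hunb with h10 | h01
  · refine ⟨-1, fun w hw => ?_⟩
    have hle : Module.End.eigenspace (φ.baseChange ℂ) c ⊓ H.piece 0 1 = Module.End.eigenspace (φ.baseChange ℂ) c :=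
      Submodule.eq_of_le_of_finrank_eq inf_le_left (by rw [hsum, h10, zero_add])
    have hw' : w ∈ Module.End.eigenspace (φ.baseChange ℂ) c ⊓ H.piece 0 1 := by rw [hle]; exact hw
    rw [hΘ01 w hw'.2, neg_one_smul]
  · refine ⟨1, fun w hw => ?_⟩
    have hle : Module.End.eigenspace (φ.baseChange ℂ) c ⊓ H.piece 1 0 = Module.End.eigenspace (φ.baseChange ℂ) c :=
      Submodule.eq_of_le_of_finrank_eq inf_le_left (by rw [hsum, h01, add_zero])
    have hw' : w ∈ Module.End.eigenspace (φ.baseChange ℂ) c ⊓ H.piece 1 0 := by rw [hle]; exact hw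
    rw [hΘ10 w hw'.2, one_smul]

omit [HodgeTensorFacts.{u, u}] in
/-- **On a balanced `𝔤`-irreducible block `Θ` does not commute with `𝔤_ℂ`**: otherwise an eigenspace of `Θ|_W` would be
`𝔤`-stable, so `Θ|_W` would be a scalar, while it has the eigenvalues `1` (on `W ∩ V^{1,0} ≠ 0`) and `−1`
(on `W ∩ V^{0,1} ≠ 0`). [cite: MoonenZarhin1999LowDim, §2 (2.3)] [cite: Deligne1982HodgeCycles, §4 (p. 30)] -/
theorem CMNoTwist.false_of_theta_commute_of_balanced (H : HodgeStructure V n) (hn : n = 1) (heff : H.IsEffective)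
    {φ : Module.End ℚ V} {Θ : Module.End ℂ (ℂ ⊗[ℚ] V)}
    (hΘ : ∀ p, ∀ x ∈ H.piece p (n - p), Θ x = ((2 * p - n : ℤ) : ℂ) • x) (hΘφ : Θ * φ.baseChange ℂ = φ.baseChange ℂ * Θ)
    (𝔤 : Submodule ℚ (Module.End ℚ V)) (hXφ : ∀ X ∈ 𝔤, X.baseChange ℂ * φ.baseChange ℂ = φ.baseChange ℂ * X.baseChange ℂ)
    {c : ℂ} (hirr : ∀ U ≤ Module.End.eigenspace (φ.baseChange ℂ) c,
      (∀ X ∈ 𝔤, ∀ u ∈ U, X.baseChange ℂ u ∈ U) → U = ⊥ ∨ U = Module.End.eigenspace (φ.baseChange ℂ) c)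
    (h10 : Module.finrank ℂ ↥(Module.End.eigenspace (φ.baseChange ℂ) c ⊓ H.piece 1 0) ≠ 0)
    (h01 : Module.finrank ℂ ↥(Module.End.eigenspace (φ.baseChange ℂ) c ⊓ H.piece 0 1) ≠ 0)
    (hcomm : ∀ X ∈ 𝔤, ∀ w ∈ Module.End.eigenspace (φ.baseChange ℂ) c, Θ (X.baseChange ℂ w) = X.baseChange ℂ (Θ w)) :
    False := by
  classical
  obtain ⟨-, -, hΘ10, hΘ01, -⟩ := UnitaryTheta.theta_facts H hn heff hΘ
  subst hn
  set W := Module.End.eigenspace (φ.baseChange ℂ) c with hWdef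
  have hΘW : ∀ w ∈ W, Θ w ∈ W := fun w hw => UnitaryTheta.apply_mem_eigenspace_of_commute hΘφ hw
  have hXW : ∀ X ∈ 𝔤, ∀ w ∈ W, X.baseChange ℂ w ∈ W := fun X hX w hw =>
    UnitaryTheta.apply_mem_eigenspace_of_commute (hXφ X hX) hw
  -- non-zero vectors of `W` of type `(1,0)` and `(0,1)`
  obtain ⟨w₁, hw₁, hw₁0⟩ := Submodule.exists_mem_ne_zero_of_ne_bot
    (fun h => h10 (by rw [h, finrank_bot]) : W ⊓ H.piece 1 0 ≠ ⊥)
  obtain ⟨w₂, hw₂, hw₂0⟩ := Submodule.exists_mem_ne_zero_of_ne_bot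
    (fun h => h01 (by rw [h, finrank_bot]) : W ⊓ H.piece 0 1 ≠ ⊥)
  -- an eigenvalue of `Θ|_W`, whose eigenspace in `W` is `𝔤`-stable, hence everything
  haveI : Nontrivial ↥W := ⟨⟨⟨w₁, hw₁.1⟩, 0, fun h => hw₁0 (congrArg Subtype.val h)⟩⟩
  obtain ⟨ev, hev⟩ := Module.End.exists_eigenvalue (Θ.restrict hΘW)
  obtain ⟨v, hv⟩ := hev.exists_hasEigenvector
  have hvev : Θ (v : ℂ ⊗[ℚ] V) = ev • (v : ℂ ⊗[ℚ] V) := by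
    have h := congrArg Subtype.val (Module.End.mem_eigenspace_iff.1 hv.1)
    rwa [LinearMap.coe_restrict_apply, Submodule.coe_smul] at h
  set U : Submodule ℂ (ℂ ⊗[ℚ] V) := W ⊓ Module.End.eigenspace Θ ev with hUdef
  have hUst : ∀ X ∈ 𝔤, ∀ u ∈ U, X.baseChange ℂ u ∈ U := by
    intro X hX u hu
    obtain ⟨huW, huev⟩ := Submodule.mem_inf.1 hu
    refine Submodule.mem_inf.2 ⟨hXW X hX u huW, Module.End.mem_eigenspace_iff.2 ?_⟩
    rw [hcomm X hX u huW, Module.End.mem_eigenspace_iff.1 huev, map_smul]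
  have hUne : U ≠ ⊥ := by
    intro h
    have hvU : (v : ℂ ⊗[ℚ] V) ∈ U := Submodule.mem_inf.2 ⟨v.2, Module.End.mem_eigenspace_iff.2 hvev⟩
    rw [h, Submodule.mem_bot] at hvU
    exact hv.2 (Subtype.ext hvU)
  have hUeq : U = W := (hirr U inf_le_left hUst).resolve_left hUne
  have hevW : ∀ w ∈ W, Θ w = ev • w := fun w hw => by
    have : w ∈ U := by rw [hUeq]; exact hw
    exact Module.End.mem_eigenspace_iff.1 (Submodule.mem_inf.1 this).2
  -- `ev = 1` and `ev = -1`
  have h1 : ev = 1 := by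
    have h := hevW w₁ hw₁.1
    rw [hΘ10 w₁ hw₁.2] at h
    have h' : (ev - 1) • w₁ = 0 := by rw [sub_smul, one_smul, ← h, sub_self]
    exact sub_eq_zero.1 ((smul_eq_zero.1 h').resolve_right hw₁0)
  have h2 : ev = -1 := by
    have h := hevW w₂ hw₂.1
    rw [hΘ01 w₂ hw₂.2] at h
    have h' : (ev + 1) • w₂ = 0 := by rw [add_smul, one_smul, ← h, neg_add_cancel]
    exact (eq_neg_of_add_eq_zero_left ((smul_eq_zero.1 h').resolve_right hw₂0))
  rw [h1] at h2
  norm_num at h2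

/-- **`φ†` acts on `W_{μ k}` by `conj (μ k)`** (the Rosati involution is complex conjugation on the CM field `E = ℚ[φ]`):
`ψ_ℂ(φ†_ℂ w, w′) = ψ_ℂ(w, φ_ℂ w′) = conj(μ k) ψ_ℂ(w, w′)` against the dual vector `w′ ∈ W_{conj μ k}` of an adapted dual basis.
[cite: MoonenZarhin1999LowDim, §1] [cite: Deligne1982HodgeCycles, §4 (p. 30)] -/
theorem CMNoTwist.adjoint_baseChange_apply {ι : Type} [Fintype ι] [DecidableEq ι] (H : HodgeStructure V n) (hn : n = 1)
    (heff : H.IsEffective) (ψ : H.Polarization) {φ : Module.End ℚ V} (hφE : φ ∈ H.endAlg) {m : ℕ}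
    (hE : ∀ a ∈ H.endAlg, ∃ q : Fin m → ℚ, a = ∑ k, q k • φ ^ (k : ℕ))
    (μ : ι → ℂ) (hinj : Function.Injective μ) (hdist : ∀ k k', μ k' ≠ starRingEnd ℂ (μ k)) {n₀ : ℕ} (hn₀ : n₀ ≠ 0)
    (hrank : ∀ k, Module.finrank ℂ ↥(Module.End.eigenspace (φ.baseChange ℂ) (μ k) ⊓ H.piece 1 0) +
      Module.finrank ℂ ↥(Module.End.eigenspace (φ.baseChange ℂ) (μ k) ⊓ H.piece 0 1) = n₀)
    (htop : (⨆ kt : ι × Fin 2, Module.End.eigenspace (φ.baseChange ℂ)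
      (if kt.2 = 0 then μ kt.1 else starRingEnd ℂ (μ kt.1))) = ⊤)
    (k : ι) : ∀ w ∈ Module.End.eigenspace (φ.baseChange ℂ) (μ k),
      (ψ.adjoint φ).baseChange ℂ w = starRingEnd ℂ (μ k) • w := by
  classical
  obtain ⟨cb, κ, hcbW, hcbW', -, -, hdual, -⟩ :=
    CMTheta.exists_adaptedDualBasis H hn heff ψ hφE hE μ hinj hdist hrank htop
  obtain ⟨s, hs⟩ := CMTheta.exists_smul_of_mem_endAlg H hE (ψ.adjoint_mem_endAlg hφE) (μ k)
  set j₀ : Fin n₀ := ⟨0, Nat.pos_of_ne_zero hn₀⟩ with hj₀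
  have h1 : ψ.form.baseChange ℂ (cb ((k, 0), j₀)) (cb ((k, 1), j₀)) = 1 := by rw [hdual, if_pos ⟨rfl, rfl⟩]
  have hs' : s = starRingEnd ℂ (μ k) := by
    have h := ψ.form_baseChange_adjoint_left φ (cb ((k, 0), j₀)) (cb ((k, 1), j₀))
    rw [hs _ (hcbW k j₀), Module.End.mem_eigenspace_iff.1 (hcbW' k j₀), map_smul, map_smul, LinearMap.smul_apply,
      smul_eq_mul, smul_eq_mul, h1, mul_one, mul_one] at h
    exact h
  intro w hw
  rw [hs w hw, hs']

/-! ### §2 The LIFT property for one `Θ`-scalar place -/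

/-- **THE LIFT PROPERTY FOR A CM FIELD WITH ONE `Θ`-SCALAR PLACE** (see the module docstring; `n₀ = 2`, `|ι| ≤ 3`, `k₀` the
unique unbalanced place, `𝔤` bracket-closed admissible with `Θ ∈ 𝔤_ℂ` and every `W_{μ k}` `𝔤`-irreducible): for every `k`
and every traceless `Z ∈ End(W_{μ k})` there is `X ∈ 𝔤_ℂ` inducing `Z` on `W_{μ k}` and `0` on the other `W_{μ j}`.
[cite: MoonenZarhin1999LowDim, §2 (2.3)] [cite: Ribet1983, §3 and Thm. 0] [cite: Deligne1982HodgeCycles, I §3 (proof of Prop. 3.4)] -/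
theorem CMNoTwist.lift_of_unique_unbalanced {ι : Type} [Fintype ι] [DecidableEq ι] (hι : Fintype.card ι ≤ 3)
    (H : HodgeStructure V n) (hn : n = 1) (heff : H.IsEffective) (ψ : H.Polarization)
    {φ : Module.End ℚ V} (hφE : φ ∈ H.endAlg) {m : ℕ} (hE : ∀ a ∈ H.endAlg, ∃ q : Fin m → ℚ, a = ∑ k, q k • φ ^ (k : ℕ))
    (hdiv : ∀ a ∈ H.endAlg, a ≠ 0 → ∃ b : Module.End ℚ V, b * a = 1)
    (μ : ι → ℂ) (hinj : Function.Injective μ) (hdist : ∀ k k', μ k' ≠ starRingEnd ℂ (μ k))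
    (hrank : ∀ k, Module.finrank ℂ ↥(Module.End.eigenspace (φ.baseChange ℂ) (μ k) ⊓ H.piece 1 0) +
      Module.finrank ℂ ↥(Module.End.eigenspace (φ.baseChange ℂ) (μ k) ⊓ H.piece 0 1) = 2)
    (htop : (⨆ kt : ι × Fin 2, Module.End.eigenspace (φ.baseChange ℂ)
      (if kt.2 = 0 then μ kt.1 else starRingEnd ℂ (μ kt.1))) = ⊤)
    (𝔤 : Submodule ℚ (Module.End ℚ V)) (hbr : ∀ X ∈ 𝔤, ∀ X' ∈ 𝔤, X * X' - X' * X ∈ 𝔤)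
    (hcomm : ∀ X ∈ 𝔤, ∀ a : H.endAlg, X * (a : Module.End ℚ V) = (a : Module.End ℚ V) * X)
    (hskew : ∀ X ∈ 𝔤, ∀ v w, ψ.form (X v) w + ψ.form v (X w) = 0)
    {Θ : Module.End ℂ (ℂ ⊗[ℚ] V)} (hΘ : ∀ p, ∀ x ∈ H.piece p (n - p), Θ x = ((2 * p - n : ℤ) : ℂ) • x)
    (hΘ𝔤 : Θ ∈ spanC 𝔤)
    (hirr : ∀ k, ∀ U ≤ Module.End.eigenspace (φ.baseChange ℂ) (μ k),
      (∀ X ∈ 𝔤, ∀ u ∈ U, X.baseChange ℂ u ∈ U) → U = ⊥ ∨ U = Module.End.eigenspace (φ.baseChange ℂ) (μ k))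
    (k₀ : ι) (hk₀ : Module.finrank ℂ ↥(Module.End.eigenspace (φ.baseChange ℂ) (μ k₀) ⊓ H.piece 1 0) = 0 ∨
      Module.finrank ℂ ↥(Module.End.eigenspace (φ.baseChange ℂ) (μ k₀) ⊓ H.piece 0 1) = 0)
    (hbal : ∀ k, k ≠ k₀ → Module.finrank ℂ ↥(Module.End.eigenspace (φ.baseChange ℂ) (μ k) ⊓ H.piece 1 0) ≠ 0 ∧
      Module.finrank ℂ ↥(Module.End.eigenspace (φ.baseChange ℂ) (μ k) ⊓ H.piece 0 1) ≠ 0)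
    (k : ι) (Z : Module.End ℂ ↥(Module.End.eigenspace (φ.baseChange ℂ) (μ k))) (hZ : LinearMap.trace ℂ _ Z = 0) :
    ∃ X ∈ spanC 𝔤, (∀ w : ↥(Module.End.eigenspace (φ.baseChange ℂ) (μ k)), X w = Z w) ∧
      ∀ j, j ≠ k → ∀ w ∈ Module.End.eigenspace (φ.baseChange ℂ) (μ j), X w = 0 := by
  classical
  -- notation and basic facts
  haveI : Module.Free ℚ V := Module.Free.of_divisionRing ℚ V
  let W : ι → Submodule ℂ (ℂ ⊗[ℚ] V) := fun i => Module.End.eigenspace (φ.baseChange ℂ) (μ i)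
  have hWdef : ∀ i, W i = Module.End.eigenspace (φ.baseChange ℂ) (μ i) := fun i => rfl
  let 𝔡 : Submodule ℚ (Module.End ℚ V) := Submodule.span ℚ {B | ∃ X ∈ 𝔤, ∃ X' ∈ 𝔤, X * X' - X' * X = B}
  have h𝔡def : 𝔡 = Submodule.span ℚ {B | ∃ X ∈ 𝔤, ∃ X' ∈ 𝔤, X * X' - X' * X = B} := rfl
  have h𝔡𝔤 : 𝔡 ≤ 𝔤 := CMDerived.derived_le hbr
  have h𝔇𝔊 : spanC 𝔡 ≤ spanC 𝔤 := spanC_mono h𝔡𝔤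
  have hSφ : ∀ Y ∈ spanC 𝔤, Y * φ.baseChange ℂ = φ.baseChange ℂ * Y := fun Y hY =>
    UnitaryTheta.commute_of_mem_spanC H hφE hcomm hY
  have hSW : ∀ Y ∈ spanC 𝔤, ∀ i, ∀ w ∈ W i, Y w ∈ W i := fun Y hY i w hw =>
    UnitaryTheta.apply_mem_eigenspace_of_commute (hSφ Y hY) hw
  have hXφ : ∀ X ∈ 𝔤, X.baseChange ℂ * φ.baseChange ℂ = φ.baseChange ℂ * X.baseChange ℂ := fun X hX =>
    UnitaryTheta.baseChange_commute H hφE hcomm hX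
  have hXW : ∀ X ∈ 𝔤, ∀ i, ∀ w ∈ W i, X.baseChange ℂ w ∈ W i := fun X hX i w hw =>
    UnitaryTheta.apply_mem_eigenspace_of_commute (hXφ X hX) hw
  have hΘφ : Θ * φ.baseChange ℂ = φ.baseChange ℂ * Θ := hSφ Θ hΘ𝔤
  have hfin : ∀ i, Module.finrank ℂ ↥(W i) = 2 := fun i => by
    rw [hWdef, CMTheta.finrank_eigenspace_eq_add H hn heff hφE, hrank i]
  let bW : ∀ i, Module.Basis (Fin 2) ℂ ↥(W i) := fun i => Module.finBasisOfFinrankEq ℂ _ (hfin i)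
  -- the complex derived span `𝔇` and the inputs of Ribet's lemma
  have hbr𝔇 : ∀ X ∈ spanC 𝔡, ∀ Y ∈ spanC 𝔡, X * Y - Y * X ∈ spanC 𝔡 := fun X hX Y hY =>
    commutator_mem_spanC_derived (h𝔇𝔊 hX) (h𝔇𝔊 hY)
  have hW𝔇 : ∀ X ∈ spanC 𝔡, ∀ i, ∀ w ∈ W i, X w ∈ W i := fun X hX i => hSW X (h𝔇𝔊 hX) i
  have htr𝔇 : ∀ X (hX : X ∈ spanC 𝔡) i, LinearMap.trace ℂ _ (X.restrict (hW𝔇 X hX i)) = 0 := fun X hX i =>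
    CMDerived.trace_restrict_eq_zero (fun Y hY => hXW Y hY i) hX _
  have hproj : ∀ i, ∀ Z : Module.End ℂ ↥(W i), LinearMap.trace ℂ _ Z = 0 → ∃ X ∈ spanC 𝔡, ∀ w : ↥(W i), X w = Z w :=
    fun i Z hZ => CMDerived.exists_mem_spanC_derived_forall_eq 𝔤 hbr (W i) (hfin i) (fun X hX => hXW X hX i) (hirr i) Z hZ
  have P := fun i₀ => Literature.Algebra.Lie.LieGoursatTwist.lift_or_twist_of_submodules (k := ℂ) W (d := 2) le_rfl bW
    (spanC 𝔡) hbr𝔇 hW𝔇 htr𝔇 hproj i₀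
  -- the matrices `M i X = [X|_{W i}]`; zero matrix ⟺ zero restriction
  have hM0 : ∀ i X (hX : X ∈ spanC 𝔡), LinearMap.toMatrix (bW i) (bW i) (X.restrict (hW𝔇 X hX i)) = 0 ↔
      ∀ w ∈ W i, X w = 0 := by
    intro i X hX
    rw [LinearEquiv.map_eq_zero_iff]
    constructor
    · intro h w hw
      have h' := LinearMap.congr_fun h ⟨w, hw⟩
      rw [LinearMap.zero_apply] at h'
      have h'' := congrArg Subtype.val h'
      rwa [LinearMap.coe_restrict_apply] at h''
    · intro h
      exact LinearMap.ext fun w => Subtype.ext (by rw [LinearMap.coe_restrict_apply, h w w.2]; rfl)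
  -- a twist `(i₀, j)` transports vanishing of restrictions in both directions
  have htrans : ∀ i₀ j (e : Fin 2 ≃ Fin 2) (A : Matrix (Fin 2) (Fin 2) ℂ), IsUnit A →
      (∀ X (hX : X ∈ spanC 𝔡), LinearMap.toMatrix (bW i₀) (bW i₀) (X.restrict (hW𝔇 X hX i₀)) =
        A⁻¹ * (LinearMap.toMatrix (bW j) (bW j) (X.restrict (hW𝔇 X hX j))).submatrix e.symm e.symm * A) →
      ∀ X (hX : X ∈ spanC 𝔡), ((∀ w ∈ W j, X w = 0) → ∀ w ∈ W i₀, X w = 0) ∧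
        ((∀ w ∈ W i₀, X w = 0) → ∀ w ∈ W j, X w = 0) := by
    intro i₀ j e A hA htw X hX
    constructor
    · intro h
      rw [← hM0 i₀ X hX, htw X hX, (hM0 j X hX).2 h, Matrix.submatrix_zero, Pi.zero_def, Pi.zero_def, Matrix.mul_zero,
        Matrix.zero_mul]
    · intro h
      have h1 := htw X hX
      rw [(hM0 i₀ X hX).2 h] at h1
      exact (hM0 j X hX).1 (CMNoTwist.eq_zero_of_conj_submatrix_eq_zero e hA h1.symm)
  -- a MIXED twist (between an unbalanced `u` and a balanced `b'`) is impossible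
  have hmixed : ∀ u b', (Module.finrank ℂ ↥(W u ⊓ H.piece 1 0) = 0 ∨ Module.finrank ℂ ↥(W u ⊓ H.piece 0 1) = 0) →
      (Module.finrank ℂ ↥(W b' ⊓ H.piece 1 0) ≠ 0 ∧ Module.finrank ℂ ↥(W b' ⊓ H.piece 0 1) ≠ 0) →
      (∀ X (hX : X ∈ spanC 𝔡), (∀ w ∈ W u, X w = 0) → ∀ w ∈ W b', X w = 0) → False := by
    intro u b' hu hb' himp
    obtain ⟨ε, hε⟩ := CMNoTwist.theta_eq_smul_of_unbalanced H hn heff hφE hΘ hu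
    refine CMNoTwist.false_of_theta_commute_of_balanced H hn heff hΘ hΘφ 𝔤 hXφ (hirr b') hb'.1 hb'.2 fun X hX w hw => ?_
    have hC : Θ * X.baseChange ℂ - X.baseChange ℂ * Θ ∈ spanC 𝔡 :=
      commutator_mem_spanC_derived hΘ𝔤 (baseChange_mem_spanC hX)
    have hu0 : ∀ w ∈ W u, (Θ * X.baseChange ℂ - X.baseChange ℂ * Θ) w = 0 := fun w hw => by
      rw [LinearMap.sub_apply, Module.End.mul_apply, Module.End.mul_apply, hε _ (hXW X hX u w hw), hε w hw, map_smul,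
        sub_self]
    have h := himp _ hC hu0 w hw
    rw [LinearMap.sub_apply, Module.End.mul_apply, Module.End.mul_apply, sub_eq_zero] at h
    exact h
  -- LIFT at `k₀` (a twist from `k₀` would be mixed)
  have hLk₀ : ∀ Z : Module.End ℂ ↥(W k₀), LinearMap.trace ℂ _ Z = 0 →
      ∃ X ∈ spanC 𝔡, (∀ w : ↥(W k₀), X w = Z w) ∧ ∀ j, j ≠ k₀ → ∀ w ∈ W j, X w = 0 := by
    rcases P k₀ with h | ⟨j, hj, e, A, hA, htw⟩
    · exact h
    · exfalso
      rcases htw with htw | ⟨h22, -⟩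
      · exact hmixed k₀ j hk₀ (hbal j hj) fun X hX => (htrans k₀ j e A hA htw X hX).2
      · exact lt_irrefl 2 h22
  -- the place `k` itself
  by_cases hkk₀ : k = k₀
  · subst hkk₀
    obtain ⟨X, hX, h1, h2⟩ := hLk₀ Z hZ
    exact ⟨X, h𝔇𝔊 hX, h1, h2⟩
  rcases P k with h | ⟨j, hj, e, A, hA, htw⟩
  · obtain ⟨X, hX, h1, h2⟩ := h Z hZ
    exact ⟨X, h𝔇𝔊 hX, h1, h2⟩
  exfalso
  rcases htw with htw | ⟨h22, -⟩
  swap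
  · exact lt_irrefl 2 h22
  by_cases hjk₀ : j = k₀
  · subst hjk₀
    exact hmixed j k hk₀ (hbal k hkk₀) fun X hX => (htrans k j e A hA htw X hX).1
  /- SAME TYPE: `k` and `j` are the two balanced places, `k₀` the unbalanced one. -/
  -- every place is one of `k, j, k₀`
  have huniv : ∀ i, i = k ∨ i = j ∨ i = k₀ := by
    have h3 : ({k, j, k₀} : Finset ι) = Finset.univ := by
      apply Finset.eq_of_subset_of_card_le (Finset.subset_univ _)
      rw [Finset.card_univ, Finset.card_insert_of_notMem (by simp [Ne.symm hj, hkk₀]),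
        Finset.card_insert_of_notMem (by simp [hjk₀]), Finset.card_singleton]
      exact hι
    intro i
    have hi : i ∈ ({k, j, k₀} : Finset ι) := by rw [h3]; exact Finset.mem_univ _
    simpa using hi
  -- `dim_ℚ 𝔡 ≥ 6`: restriction to `W k` is onto `𝔰𝔩(W k)` and its kernel maps onto `𝔰𝔩(W k₀)`
  have hδ : 6 ≤ Module.finrank ℚ 𝔡 := by
    rw [← finrank_spanC_eq]
    exact CMNoTwist.six_le_finrank (spanC 𝔡) (W k) (W k₀) (hfin k) (hfin k₀) (fun X hX => hW𝔇 X hX k)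
      (fun X hX => hW𝔇 X hX k₀) (hproj k) fun T hT => by
        obtain ⟨X, hX, hXT, hX0⟩ := hLk₀ T hT
        exact ⟨X, hX, hXT, hX0 k hkk₀⟩
  -- the symmetric element `b ∈ {φ + φ†, φφ†}` separating the places `k` and `j`
  have hadj := CMNoTwist.adjoint_baseChange_apply H hn heff ψ hφE hE μ hinj hdist two_ne_zero hrank htop
  have hEcomm : ∀ a ∈ H.endAlg, ∀ a' ∈ H.endAlg, a * a' = a' * a := fun a ha a' ha' =>
    CMThetaCentre.mul_comm_of_hE H hE ha ha'
  have hφadjE : ψ.adjoint φ ∈ H.endAlg := ψ.adjoint_mem_endAlg hφE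
  obtain ⟨b, τ, hbE, hbsym, hbτ, hτ⟩ : ∃ (b : Module.End ℚ V) (τ : ι → ℂ), b ∈ H.endAlg ∧
      (∀ v w, ψ.form (b v) w = ψ.form v (b w)) ∧ (∀ i, ∀ w ∈ W i, b.baseChange ℂ w = τ i • w) ∧ τ k ≠ τ j := by
    by_cases hs : μ k + starRingEnd ℂ (μ k) = μ j + starRingEnd ℂ (μ j)
    · refine ⟨φ * ψ.adjoint φ, fun i => μ i * starRingEnd ℂ (μ i), H.endAlg.mul_mem hφE hφadjE, fun v w => ?_,
        fun i w hw => ?_, fun h => ?_⟩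
      · rw [Module.End.mul_apply, Module.End.mul_apply, ← ψ.form_apply_adjoint, ψ.isAdjointPair_adjoint_left φ]
      · rw [LinearMap.baseChange_mul, Module.End.mul_apply, hadj i w hw, map_smul, Module.End.mem_eigenspace_iff.1 hw,
          smul_smul, mul_comm]
      · -- same sum and product: `μ j ∈ {μ k, conj μ k}`
        have hq : (μ j - μ k) * (μ j - starRingEnd ℂ (μ k)) = 0 := by linear_combination (-(μ j)) * hs + h
        rcases mul_eq_zero.1 hq with h1 | h1
        · exact hj (hinj (sub_eq_zero.1 h1))
        · exact hdist k j (sub_eq_zero.1 h1)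
    · refine ⟨φ + ψ.adjoint φ, fun i => μ i + starRingEnd ℂ (μ i), add_mem hφE hφadjE, fun v w => ?_,
        fun i w hw => ?_, hs⟩
      · rw [LinearMap.add_apply, LinearMap.add_apply, map_add, LinearMap.add_apply, map_add, ← ψ.form_apply_adjoint,
          ψ.isAdjointPair_adjoint_left φ, add_comm]
      · rw [LinearMap.baseChange_add, LinearMap.add_apply, hadj i w hw, Module.End.mem_eigenspace_iff.1 hw, add_smul]
  have hb0 : b ≠ 0 := by
    intro h
    have h1 := hbτ k _ (bW k 0).2
    have h2 := hbτ j _ (bW j 0).2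
    rw [h, LinearMap.baseChange_zero, LinearMap.zero_apply] at h1 h2
    have e1 : τ k = 0 := by
      by_contra hne
      exact (Submodule.coe_eq_zero.not.2 ((bW k).ne_zero 0)) ((smul_eq_zero.1 h1.symm).resolve_left hne)
    have e2 : τ j = 0 := by
      by_contra hne
      exact (Submodule.coe_eq_zero.not.2 ((bW j).ne_zero 0)) ((smul_eq_zero.1 h2.symm).resolve_left hne)
    exact hτ (e1.trans e2.symm)
  -- `N′ = {X ∈ 𝔡 : bX ∈ 𝔡}` has dimension `≥ 3`
  obtain ⟨binv, hbinv⟩ := hdiv b hbE hb0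
  have hLinj : Function.Injective (LinearMap.mulLeft ℚ b) := by
    rw [← LinearMap.ker_eq_bot, eq_bot_iff]
    intro a ha
    rw [LinearMap.mem_ker, LinearMap.mulLeft_apply] at ha
    rw [Submodule.mem_bot, ← one_mul a, ← hbinv, mul_assoc, ha, mul_zero]
  set N' : Submodule ℚ (Module.End ℚ V) := 𝔡 ⊓ 𝔡.comap (LinearMap.mulLeft ℚ b) with hN'
  have hN'3 : 3 ≤ Module.finrank ℚ N' := by
    have hsup : Module.finrank ℚ ↥(𝔡 ⊔ 𝔡.map (LinearMap.mulLeft ℚ b)) ≤ 9 :=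
      (CMDerived.finrank_sup_map_mulLeft_le H hn heff ψ hφE hE μ hinj hdist two_ne_zero hrank htop 𝔤 hbr hcomm hskew hbE
        hbsym).trans (by
          have h3 : (2 : ℕ) ^ 2 - 1 = 3 := by norm_num
          rw [h3]; omega)
    have hmap : Module.finrank ℚ ↥(𝔡.map (LinearMap.mulLeft ℚ b)) = Module.finrank ℚ 𝔡 :=
      (Submodule.equivMapOfInjective _ hLinj 𝔡).finrank_eq.symm
    have hinf := Submodule.finrank_sup_add_finrank_inf_eq 𝔡 (𝔡.map (LinearMap.mulLeft ℚ b))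
    have hle : 𝔡 ⊓ 𝔡.map (LinearMap.mulLeft ℚ b) ≤ N'.map (LinearMap.mulLeft ℚ b) := by
      rintro Y ⟨hY, hY'⟩
      obtain ⟨X, hX, rfl⟩ := Submodule.mem_map.1 hY'
      exact Submodule.mem_map.2 ⟨X, ⟨hX, hY⟩, rfl⟩
    have h1 := (Submodule.finrank_mono hle).trans (Submodule.finrank_map_le _ N')
    omega
  obtain ⟨X, hXN, hX0⟩ := Submodule.exists_mem_ne_zero_of_ne_bot
    (fun h => by rw [h, finrank_bot] at hN'3; omega : N' ≠ ⊥)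
  obtain ⟨hX𝔡, hbX𝔡⟩ := Submodule.mem_inf.1 hXN
  rw [Submodule.mem_comap, LinearMap.mulLeft_apply] at hbX𝔡
  -- the twist forces `X_ℂ` to vanish on `W k` and on `W j`
  have hXC : X.baseChange ℂ ∈ spanC 𝔡 := baseChange_mem_spanC hX𝔡
  have hbXC : (b * X).baseChange ℂ ∈ spanC 𝔡 := baseChange_mem_spanC hbX𝔡
  have hMb : ∀ i, LinearMap.toMatrix (bW i) (bW i) (((b * X).baseChange ℂ).restrict (hW𝔇 _ hbXC i)) =
      τ i • LinearMap.toMatrix (bW i) (bW i) ((X.baseChange ℂ).restrict (hW𝔇 _ hXC i)) := by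
    intro i
    rw [← LinearEquiv.map_smul]
    congr 1
    exact LinearMap.ext fun w => Subtype.ext (by
      rw [LinearMap.coe_restrict_apply, LinearMap.smul_apply, Submodule.coe_smul, LinearMap.coe_restrict_apply,
        LinearMap.baseChange_mul, Module.End.mul_apply, hbτ i _ (hW𝔇 _ hXC i _ w.2)])
  have hXk : ∀ w ∈ W k, X.baseChange ℂ w = 0 := by
    rw [← hM0 k _ hXC]
    have h1 := htw _ hXC
    have h2 := htw _ hbXC
    rw [hMb k, hMb j] at h2
    simp only [Matrix.submatrix_smul, Pi.smul_apply, Matrix.mul_smul, Matrix.smul_mul] at h2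
    rw [← h1] at h2
    have h3 : (τ k - τ j) • LinearMap.toMatrix (bW k) (bW k) ((X.baseChange ℂ).restrict (hW𝔇 _ hXC k)) = 0 := by
      rw [sub_smul, h2, sub_self]
    exact (smul_eq_zero.1 h3).resolve_left (sub_ne_zero.2 hτ)
  have hXj : ∀ w ∈ W j, X.baseChange ℂ w = 0 := (htrans k j e A hA htw _ hXC).2 hXk
  -- hence `X_ℂ` kills every balanced block, so `X = 0`: contradiction
  refine hX0 (CMDerived.eq_zero_of_forall_balanced H hn heff ψ hφE hE μ hinj hdist two_ne_zero hrank htop 𝔤 hbr hcomm hskew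
    hΘ hΘ𝔤 hirr hX𝔡 fun i h10 h01 => ?_)
  rcases huniv i with rfl | rfl | rfl
  · exact hXk
  · exact hXj
  · exact (hk₀.elim (fun h => (h10 h).elim) fun h => (h01 h).elim)

end Hodge

end HodgeStructure

end Literature.AlgebraicGeometry.Motives
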